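import Summits.QuantumFields.BalabanUV.T4Continuum.Spine.NE2.ComposedRemainderTower

/-!
# T⁴ programme, spine node NE2 (U1a) — R14 W3a, file 1: DATA-LIPSCHITZ LAWS OF THE ONE-STEP OBJECTS OF [B7] (124) — the main table, the one-step averaging and the remainder `Q″` as
# functions of the background data (cell `pub-balaban-gaps`, seat ne2 gen 5; plan `ne/NE2-R14-PLAN.md` STATUS v5, item W3a)

The two sandwiched two-level fields of the remainder datum `hRem` (gen 5's `ComposedFullAveragingRate.composed_full_averaging_rate` displays them as `hRem₂`/`hRem₃`) compare the composed
remainder of the problem at level `k+1` with that of the problem at level `k`; one of their two ingredients is the dependence of the one-step objects on the DATA (the other — the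
same-data two-level pairing against `Δ_a⁻¹`, King's mechanism — is not in this file).  THIS FILE proves the one-step data-Lipschitz laws, all in the currency of file 2's domination:
 * **`norm_Smain_sub_Smain_le`**: `‖Smain(V′) − Smain(V)‖ ≤ (1 + c)^{(d+1)L} − 1` entrywise from per-bond `‖V′ − V‖ ≤ c` (`V` contractive);
 * **`opNorm_Qstep_sub_Qstep_le`**: `‖Q₁(S′) − Q₁(S)‖ ≤ card o·δ·(√(L^d))⁻¹` from entrywise `‖S′ − S‖ ≤ δ`;
 * `norm_coeff_diff_entry_le`, `length_combPrefix_le`, `norm_combOp_sub_apply_le`, `norm_axisOp_sub_apply_le`, and **`norm_Qrem_sub_apply_le`** / **`opNorm_Qrem_sub_le`**: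
   `‖Q″(V′,G′,R̄′) − Q″(V,G,R̄)‖ ≤ card o·2d·(2d+2)L^d·(δ_G + γ(δ_T + δ_R))·(√(L^d))⁻¹` for coefficient operators of size `≤ γ` differing by `≤ δ_G`, contractive coarse transporters differing by
   `≤ δ_R`, and contractive fine transporters differing per bond by `≤ c` (`δ_T = (1 + c)^{(d+1)L} − 1`).
HONEST FRAMING (T4-DAG p. 1).  Bookkeeping about typed operator shapes whose background data are DISPLAYED; NOT NE2, NOT [B7] (124) beyond the displayed reading; **NE2 (U1a) NOT PROVED**;
spine PROVED 0/9 unchanged; NOT continuum YM / infinite volume / mass gap / Clay.  HONEST DEPENDENCY: continuum YM on T⁴ ⇐ BetaPertH ∧ nine spine estimates (0/9 proved); BetaPertH ⇐ (D1)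
∧ (D4) ∧ CAP+tail.  No `sorry`.
-/

noncomputable section

open scoped BigOperators ComplexConjugate Matrix Matrix.Norms.L2Operator Kronecker

namespace Summit.QuantumFields.BalabanUV.T4Continuum.NE2.OneStepRemainderLipschitz

open Literature.MathematicalPhysics.QuantumFieldTheory.Balaban1983to89.B5Prop11Plancherel (Tor fine unitVec)
open Literature.MathematicalPhysics.QuantumFieldTheory.Balaban1983to89.B5Block118 (tstep)
open Literature.MathematicalPhysics.QuantumFieldTheory.Balaban1983to89.B5G183RateTorus (cpt)
open Literature.MathematicalPhysics.QuantumFieldTheory.Balaban1983to89.B5G183RateTorusW (off)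
open Summit.QuantumFields.BalabanUV.T4Continuum
open Summit.QuantumFields.BalabanUV.T4Continuum.BalabanAveragedTowerUnit (norm_entry_le_opNorm)
open Summit.QuantumFields.BalabanUV.T4Continuum.CovariantBlockAveraging (transport leg length_leg)
open Summit.QuantumFields.BalabanUV.T4Continuum.CovariantVectorChartModulus (norm_transport_le_one norm_transport_sub_transport_le)
open Summit.QuantumFields.BalabanUV.T4Continuum.NE2.CovariantTableBalaban (contourFrom length_contourFrom)
open Summit.QuantumFields.BalabanUV.T4Continuum.NE2.ComposedAveragingIdentity (Qstep)
open Summit.QuantumFields.BalabanUV.T4Continuum.NE2.OneStepRemainder (blockInd blockInd_nonneg blockInd_cpt_add_off qtwo blockInd_le_qtwo_left blockInd_le_qtwo_right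
  opNorm_le_of_dominated Smain cutAt combPt combPrefix combPt_cpt combOp axisOp Qrem one_le_blockInd_line axis_pt_eq norm_Qstep_apply_le)
open Summit.QuantumFields.BalabanUV.T4Continuum.NE2.ComposedRemainderTower (Qstep_sub opNorm_Qstep_le_of_entry)

variable {d : ℕ} (n L : ℕ) [NeZero n] [NeZero L] (M : Fin d → ℕ) [hM : ∀ μ, NeZero (M μ)] {o : Type*} [Fintype o] [DecidableEq o] [Nonempty o]

/-! ## §1 The main table and the one-step averaging -/

omit hM in
/-- **`‖Smain(V′) − Smain(V)‖ ≤ (1 + c)^{(d+1)L} − 1`** entrywise (`s < L`) from per-bond `‖V′ − V‖ ≤ c`, `V` contractive. [folklore] -/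
theorem norm_Smain_sub_Smain_le {V V' : Fin d → (Tor (fine (L * n) M) × Fin d → Matrix o o ℂ)} {c : ℝ} (hc : 0 ≤ c) (hV : ∀ ν b, ‖V ν b‖ ≤ 1)
    (hVV : ∀ ν b, ‖V' ν b - V ν b‖ ≤ c) (x : Tor (fine n M)) (r : Fin d → Fin L) (μ : Fin d) (s : Fin L) :
    ‖Smain n L M V' x r μ s - Smain n L M V x r μ s‖ ≤ (1 + c) ^ ((d + 1) * L) - 1 := by
  rw [Smain, Smain]
  refine norm_transport_sub_transport_le (fine (L * n) M) hc hV hVV μ ?_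
  rw [length_contourFrom]
  calc (∑ ν, (r ν : ℕ)) + (s : ℕ) ≤ (∑ _ν : Fin d, L) + L := add_le_add (Finset.sum_le_sum fun ν _ => (r ν).isLt.le) s.isLt.le
    _ = (d + 1) * L := by rw [Finset.sum_const, Finset.card_univ, Fintype.card_fin, smul_eq_mul]; ring

omit [Nonempty o] in
/-- **`‖Q₁(S′) − Q₁(S)‖ ≤ card o·δ·(√(L^d))⁻¹`** from entrywise `‖S′ − S‖ ≤ δ` (`s < L`). [folklore] -/
theorem opNorm_Qstep_sub_Qstep_le {S S' : Tor (fine n M) → (Fin d → Fin L) → Fin d → ℕ → Matrix o o ℂ} {δ : ℝ} (hδ : 0 ≤ δ)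
    (hS : ∀ x r μ (s : Fin L), ‖S' x r μ s - S x r μ s‖ ≤ δ) : ‖Qstep n L M S' - Qstep n L M S‖ ≤ Fintype.card o * δ * (Real.sqrt ((L : ℝ) ^ d))⁻¹ := by
  rw [Qstep_sub]
  exact opNorm_Qstep_le_of_entry n L M (S := fun x r μ s => S' x r μ s - S x r μ s) (E := fun _ _ => δ)
    (fun x r μ s α α' => (norm_entry_le_opNorm _ _ _).trans (hS x r μ s)) (mul_nonneg (Nat.cast_nonneg _) hδ)
    (fun α => by rw [Finset.sum_const, Finset.card_univ, nsmul_eq_mul]) (fun α' => by rw [Finset.sum_const, Finset.card_univ, nsmul_eq_mul])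

/-! ## §2 The remainder as a function of its data -/

omit [Nonempty o] in
/-- the entry of `w·(G′T′ − GT)` is at most `|w|·(δ_G + γδ_T)` (`‖G‖ ≤ γ`, `‖G′ − G‖ ≤ δ_G`, `‖T′‖ ≤ 1`, `‖T′ − T‖ ≤ δ_T`). [folklore] -/
theorem norm_coeff_diff_entry_le {G G' T T' : Matrix o o ℂ} {γ δG δT : ℝ} (hG : ‖G‖ ≤ γ) (hGG : ‖G' - G‖ ≤ δG) (hT' : ‖T'‖ ≤ 1) (hTT : ‖T' - T‖ ≤ δT)
    (w : ℂ) (α α' : o) : ‖w * (G' * T') α α' - w * (G * T) α α'‖ ≤ ‖w‖ * (δG + γ * δT) := by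
  have h0 : 0 ≤ γ := (norm_nonneg _).trans hG
  have hδG : 0 ≤ δG := (norm_nonneg _).trans hGG
  rw [← mul_sub, ← Matrix.sub_apply, norm_mul]
  refine mul_le_mul_of_nonneg_left ?_ (norm_nonneg _)
  have e : G' * T' - G * T = (G' - G) * T' + G * (T' - T) := by noncomm_ring
  calc ‖(G' * T' - G * T) α α'‖ ≤ ‖G' * T' - G * T‖ := norm_entry_le_opNorm _ _ _
    _ ≤ ‖G' - G‖ * ‖T'‖ + ‖G‖ * ‖T' - T‖ := by rw [e]; exact (norm_add_le _ _).trans (add_le_add (norm_mul_le _ _) (norm_mul_le _ _))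
    _ ≤ δG * 1 + γ * δT := add_le_add (mul_le_mul hGG hT' (norm_nonneg _) hδG) (mul_le_mul hG hTT (norm_nonneg _) h0)
    _ = δG + γ * δT := by rw [mul_one]

omit hM in
/-- the comb prefix has fewer than `(d+1)L` bonds. [folklore] -/
theorem length_combPrefix_le (z : Tor (fine (L * n) M)) (r : Fin d → Fin L) (ν : Fin d) (p : Fin L) :
    (combPrefix n L M z r ν p).length ≤ (d + 1) * L := by
  rw [combPrefix, length_contourFrom]
  calc (∑ κ, cutAt L r ν 0 κ) + (p : ℕ) ≤ (∑ _κ : Fin d, L) + L := by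
        refine add_le_add (Finset.sum_le_sum fun κ _ => ?_) p.isLt.le
        simp only [cutAt]
        split_ifs <;> first | exact (r κ).isLt.le | exact Nat.zero_le _
    _ = (d + 1) * L := by rw [Finset.sum_const, Finset.card_univ, Fintype.card_fin, smul_eq_mul]; ring

section Diff

variable {V V' : Fin d → (Tor (fine (L * n) M) × Fin d → Matrix o o ℂ)} {c γ δG δR : ℝ}

/-- **COMB-TERM DIFFERENCES**: `‖(combOp V′ G′ z − combOp V G z)(c,α;b,α′)‖ ≤ d·(δ_G + γ((1+c)^{(d+1)L} − 1))·[b₋ ∈ B(z)]`. [folklore] -/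
theorem norm_combOp_sub_apply_le (hγ : 0 ≤ γ) (hc : 0 ≤ c) (hV : ∀ ν b, ‖V ν b‖ ≤ 1) (hV' : ∀ ν b, ‖V' ν b‖ ≤ 1) (hVV : ∀ ν b, ‖V' ν b - V ν b‖ ≤ c)
    {G G' : Tor (fine n M) → Fin d → (Fin d → Fin L) → Matrix o o ℂ} (hG : ∀ x μ r, ‖G x μ r‖ ≤ γ) (hGG : ∀ x μ r, ‖G' x μ r - G x μ r‖ ≤ δG)
    (z : Tor (fine n M) × Fin d → Tor (fine n M)) (b : (Tor (fine n M) × Fin d) × o) (i : (Tor (fine (L * n) M) × Fin d) × o) :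
    ‖combOp n L M V' G' z b i - combOp n L M V G z b i‖ ≤ d * (δG + γ * ((1 + c) ^ ((d + 1) * L) - 1)) * blockInd n L M (z b.1) i.1.1 := by
  have hL0 : (0 : ℝ) < L := by exact_mod_cast Nat.pos_of_ne_zero (NeZero.ne L)
  have hB := blockInd_nonneg n L M (z b.1) i.1.1
  have hδG : 0 ≤ δG := by
    have h := hGG (z b.1) b.1.2 (fun _ => 0); exact (norm_nonneg _).trans h
  have hδT : 0 ≤ (1 + c) ^ ((d + 1) * L) - 1 := by have := one_le_pow₀ (M₀ := ℝ) (a := 1 + c) (by linarith) (n := (d + 1) * L); linarith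
  have hw : ‖(1 / (L : ℂ) ^ (d + 1))‖ = ((L : ℝ) ^ (d + 1))⁻¹ := by rw [one_div, norm_inv, norm_pow, Complex.norm_natCast]
  set K := δG + γ * ((1 + c) ^ ((d + 1) * L) - 1) with hK
  have hK0 : 0 ≤ K := by rw [hK]; positivity
  have hterm : ∀ (r : Fin d → Fin L) (ν : Fin d) (p : Fin L),
      ‖(if (p : ℕ) < (r ν : ℕ) ∧ i.1 = (combPt n L M (cpt n L M (z b.1)) r ν p, ν) then
          (1 / (L : ℂ) ^ (d + 1)) * (G' b.1.1 b.1.2 r * transport (fine (L * n) M) V' b.1.2 (combPrefix n L M (cpt n L M (z b.1)) r ν p)) b.2 i.2 else 0)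
        - (if (p : ℕ) < (r ν : ℕ) ∧ i.1 = (combPt n L M (cpt n L M (z b.1)) r ν p, ν) then
          (1 / (L : ℂ) ^ (d + 1)) * (G b.1.1 b.1.2 r * transport (fine (L * n) M) V b.1.2 (combPrefix n L M (cpt n L M (z b.1)) r ν p)) b.2 i.2 else 0)‖
        ≤ ((L : ℝ) ^ (d + 1))⁻¹ * K * blockInd n L M (z b.1) i.1.1 := by
    intro r ν p
    split_ifs with h
    · have hB1 : blockInd n L M (z b.1) i.1.1 = 1 := by
        rw [show i.1.1 = combPt n L M (cpt n L M (z b.1)) r ν p from congrArg Prod.fst h.2, combPt_cpt, blockInd_cpt_add_off]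
      rw [hB1, mul_one, ← hw]
      exact norm_coeff_diff_entry_le (hG _ _ _) (hGG _ _ _) (norm_transport_le_one _ hV' _ _)
        (norm_transport_sub_transport_le (fine (L * n) M) hc hV hVV b.1.2 (length_combPrefix_le n L M _ r ν p)) _ _ _
    · rw [sub_zero, norm_zero]; positivity
  calc ‖combOp n L M V' G' z b i - combOp n L M V G z b i‖
      ≤ ∑ r : Fin d → Fin L, ∑ ν : Fin d, ∑ p : Fin L, ((L : ℝ) ^ (d + 1))⁻¹ * K * blockInd n L M (z b.1) i.1.1 := by
        rw [combOp, combOp, ← Finset.sum_sub_distrib]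
        refine (norm_sum_le _ _).trans (Finset.sum_le_sum fun r _ => ?_)
        rw [← Finset.sum_sub_distrib]
        refine (norm_sum_le _ _).trans (Finset.sum_le_sum fun ν _ => ?_)
        rw [← Finset.sum_sub_distrib]
        exact (norm_sum_le _ _).trans (Finset.sum_le_sum fun p _ => hterm r ν p)
    _ = d * K * blockInd n L M (z b.1) i.1.1 := by
        simp only [Finset.sum_const, Finset.card_univ, Fintype.card_fin, nsmul_eq_mul]
        rw [Fintype.card_fun, Fintype.card_fin, Fintype.card_fin]
        push_cast
        field_simp
        ring

/-- **AXIS-TERM DIFFERENCES**: `‖(axisOp V′ G₃′ − axisOp V G₃)(c,α;b,α′)‖ ≤ (δ_G + γ((1+c)^{(d+1)L} − 1))·[b₋ ∈ B(c₋)]`. [folklore] -/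
theorem norm_axisOp_sub_apply_le (hγ : 0 ≤ γ) (hc : 0 ≤ c) (hV : ∀ ν b, ‖V ν b‖ ≤ 1) (hV' : ∀ ν b, ‖V' ν b‖ ≤ 1) (hVV : ∀ ν b, ‖V' ν b - V ν b‖ ≤ c)
    {G₃ G₃' : Tor (fine n M) → Fin d → Matrix o o ℂ} (hG : ∀ x μ, ‖G₃ x μ‖ ≤ γ) (hGG : ∀ x μ, ‖G₃' x μ - G₃ x μ‖ ≤ δG)
    (b : (Tor (fine n M) × Fin d) × o) (i : (Tor (fine (L * n) M) × Fin d) × o) :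
    ‖axisOp n L M V' G₃' b i - axisOp n L M V G₃ b i‖ ≤ (δG + γ * ((1 + c) ^ ((d + 1) * L) - 1)) * blockInd n L M b.1.1 i.1.1 := by
  have hL0 : (0 : ℝ) < L := by exact_mod_cast Nat.pos_of_ne_zero (NeZero.ne L)
  have hL1 : 1 ≤ L := Nat.pos_of_ne_zero (NeZero.ne L)
  have hB := blockInd_nonneg n L M b.1.1 i.1.1
  have hδG : 0 ≤ δG := (norm_nonneg _).trans (hGG b.1.1 b.1.2)
  have hδT : 0 ≤ (1 + c) ^ ((d + 1) * L) - 1 := by have := one_le_pow₀ (M₀ := ℝ) (a := 1 + c) (by linarith) (n := (d + 1) * L); linarith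
  have hw : ‖(1 / (L : ℂ))‖ = (L : ℝ)⁻¹ := by rw [one_div, norm_inv, Complex.norm_natCast]
  set K := δG + γ * ((1 + c) ^ ((d + 1) * L) - 1) with hK
  have hK0 : 0 ≤ K := by rw [hK]; positivity
  have hterm : ∀ s : Fin L,
      ‖(if i.1 = (cpt n L M b.1.1 + tstep (fine (L * n) M) b.1.2 (s : ℕ), b.1.2) then
          (1 / (L : ℂ)) * (G₃' b.1.1 b.1.2 * transport (fine (L * n) M) V' b.1.2 (leg (L * n) M b.1.2 (cpt n L M b.1.1) (s : ℕ))) b.2 i.2 else 0)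
        - (if i.1 = (cpt n L M b.1.1 + tstep (fine (L * n) M) b.1.2 (s : ℕ), b.1.2) then
          (1 / (L : ℂ)) * (G₃ b.1.1 b.1.2 * transport (fine (L * n) M) V b.1.2 (leg (L * n) M b.1.2 (cpt n L M b.1.1) (s : ℕ))) b.2 i.2 else 0)‖
        ≤ (L : ℝ)⁻¹ * K * blockInd n L M b.1.1 i.1.1 := by
    intro s
    have hlen : (leg (L * n) M b.1.2 (cpt n L M b.1.1) (s : ℕ)).length ≤ (d + 1) * L := by
      rw [length_leg]; exact s.isLt.le.trans (Nat.le_mul_of_pos_left L (Nat.succ_pos d))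
    have hT := norm_transport_sub_transport_le (fine (L * n) M) hc hV hVV b.1.2 hlen
    split_ifs with h
    · have hB1 : blockInd n L M b.1.1 i.1.1 = 1 := by
        rw [show i.1.1 = cpt n L M b.1.1 + tstep (fine (L * n) M) b.1.2 (s : ℕ) from congrArg Prod.fst h, axis_pt_eq, blockInd_cpt_add_off]
      rw [hB1, mul_one, ← hw]
      exact norm_coeff_diff_entry_le (hG _ _) (hGG _ _) (norm_transport_le_one _ hV' _ _) hT _ _ _
    · rw [sub_zero, norm_zero]; positivity
  calc ‖axisOp n L M V' G₃' b i - axisOp n L M V G₃ b i‖ ≤ ∑ s : Fin L, (L : ℝ)⁻¹ * K * blockInd n L M b.1.1 i.1.1 := by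
        rw [axisOp, axisOp, ← Finset.sum_sub_distrib]
        exact (norm_sum_le _ _).trans (Finset.sum_le_sum fun s _ => hterm s)
    _ = K * blockInd n L M b.1.1 i.1.1 := by
        simp only [Finset.sum_const, Finset.card_univ, Fintype.card_fin, nsmul_eq_mul]
        field_simp

/-- **THE REMAINDER AS A FUNCTION OF ITS DATA** (entrywise): for coefficient operators of size `≤ γ` differing by `≤ δ_G`, contractive coarse transporters differing by `≤ δ_R`, and
contractive fine transporters differing per bond by `≤ c`,
`‖(Q″(V′,G′,R̄′) − Q″(V,G,R̄))(c,α;b,α′)‖ ≤ (2d+2)·L^d·(δ_G + γ(δ_R + 2((1+c)^{(d+1)L} − 1)))·qtwo c b`. [folklore] -/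
theorem norm_Qrem_sub_apply_le (hγ : 0 ≤ γ) (hc : 0 ≤ c) (hV : ∀ ν b, ‖V ν b‖ ≤ 1) (hV' : ∀ ν b, ‖V' ν b‖ ≤ 1) (hVV : ∀ ν b, ‖V' ν b - V ν b‖ ≤ c)
    {G₁ G₂ G₁' G₂' : Tor (fine n M) → Fin d → (Fin d → Fin L) → Matrix o o ℂ} {G₃ Rc G₃' Rc' : Tor (fine n M) → Fin d → Matrix o o ℂ}
    (hG₁ : ∀ x μ r, ‖G₁ x μ r‖ ≤ γ) (hG₂ : ∀ x μ r, ‖G₂ x μ r‖ ≤ γ) (hG₃ : ∀ x μ, ‖G₃ x μ‖ ≤ γ) (hRc : ∀ x μ, ‖Rc x μ‖ ≤ 1) (hRc' : ∀ x μ, ‖Rc' x μ‖ ≤ 1)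
    (hGG₁ : ∀ x μ r, ‖G₁' x μ r - G₁ x μ r‖ ≤ δG) (hGG₂ : ∀ x μ r, ‖G₂' x μ r - G₂ x μ r‖ ≤ δG) (hGG₃ : ∀ x μ, ‖G₃' x μ - G₃ x μ‖ ≤ δG)
    (hRR : ∀ x μ, ‖Rc' x μ - Rc x μ‖ ≤ δR) (b : (Tor (fine n M) × Fin d) × o) (i : (Tor (fine (L * n) M) × Fin d) × o) :
    ‖Qrem n L M V' G₁' G₂' G₃' Rc' b i - Qrem n L M V G₁ G₂ G₃ Rc b i‖
      ≤ (2 * d + 2) * (L : ℝ) ^ d * (δG + γ * (δR + 2 * ((1 + c) ^ ((d + 1) * L) - 1))) * qtwo n L M b.1 i.1 := by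
  have hd : (0 : ℝ) ≤ d := Nat.cast_nonneg _
  have hL : (0 : ℝ) < (L : ℝ) ^ d := pow_pos (by exact_mod_cast Nat.pos_of_ne_zero (NeZero.ne L)) d
  have hδG : 0 ≤ δG := (norm_nonneg _).trans (hGG₃ b.1.1 b.1.2)
  have hδR : 0 ≤ δR := (norm_nonneg _).trans (hRR b.1.1 b.1.2)
  set δT := (1 + c) ^ ((d + 1) * L) - 1 with hδTdef
  have hδT : 0 ≤ δT := by have := one_le_pow₀ (M₀ := ℝ) (a := 1 + c) (by linarith) (n := (d + 1) * L); rw [hδTdef]; linarith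
  -- term 1: comb at c₋ with G₁
  have h1 : ‖combOp n L M V' G₁' (fun c => c.1) b i - combOp n L M V G₁ (fun c => c.1) b i‖ ≤ d * (δG + γ * δT) * blockInd n L M b.1.1 i.1.1 :=
    norm_combOp_sub_apply_le n L M hγ hc hV hV' hVV hG₁ hGG₁ (fun c => c.1) b i
  -- term 2: the coefficient-weighted line term
  have hS : ∀ x r μ (s : Fin L), ‖G₁ x μ r * Smain n L M V x r μ s‖ ≤ γ := fun x r μ s =>
    (norm_mul_le _ _).trans ((mul_le_mul (hG₁ x μ r) (norm_transport_le_one _ hV _ _) (norm_nonneg _) hγ).trans (le_of_eq (mul_one γ)))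
  have hSS : ∀ x r μ (s : Fin L), ‖G₁' x μ r * Smain n L M V' x r μ s - G₁ x μ r * Smain n L M V x r μ s‖ ≤ δG + γ * δT := by
    intro x r μ s
    have e : G₁' x μ r * Smain n L M V' x r μ s - G₁ x μ r * Smain n L M V x r μ s
        = (G₁' x μ r - G₁ x μ r) * Smain n L M V' x r μ s + G₁ x μ r * (Smain n L M V' x r μ s - Smain n L M V x r μ s) := by noncomm_ring
    rw [e]
    calc _ ≤ ‖G₁' x μ r - G₁ x μ r‖ * ‖Smain n L M V' x r μ s‖ + ‖G₁ x μ r‖ * ‖Smain n L M V' x r μ s - Smain n L M V x r μ s‖ :=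
          (norm_add_le _ _).trans (add_le_add (norm_mul_le _ _) (norm_mul_le _ _))
      _ ≤ δG * 1 + γ * δT := add_le_add (mul_le_mul (hGG₁ x μ r) (norm_transport_le_one _ hV' _ _) (norm_nonneg _) hδG)
          (mul_le_mul (hG₁ x μ r) (norm_Smain_sub_Smain_le n L M hc hV hVV x r μ s) (norm_nonneg _) hγ)
      _ = δG + γ * δT := by rw [mul_one]
  have h2 : ‖Qstep n L M (fun x r μ s => G₁' x μ r * Smain n L M V' x r μ s) b i - Qstep n L M (fun x r μ s => G₁ x μ r * Smain n L M V x r μ s) b i‖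
      ≤ (δG + γ * δT) * (blockInd n L M b.1.1 i.1.1 + blockInd n L M (b.1.1 + unitVec (fine n M) b.1.2) i.1.1) := by
    rw [← Matrix.sub_apply, Qstep_sub]
    exact norm_Qstep_apply_le n L M (by positivity) (S := fun x r μ s => G₁' x μ r * Smain n L M V' x r μ s - G₁ x μ r * Smain n L M V x r μ s) hSS b i
  -- term 3: comb at c₊ with −G₂·R̄
  have hG₂R : ∀ x μ r, ‖-(G₂ x μ r * Rc x μ)‖ ≤ γ := fun x μ r => by
    rw [norm_neg]; exact (norm_mul_le _ _).trans ((mul_le_mul (hG₂ x μ r) (hRc x μ) (norm_nonneg _) hγ).trans (le_of_eq (mul_one γ)))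
  have hG₂R' : ∀ x μ r, ‖-(G₂' x μ r * Rc' x μ) - -(G₂ x μ r * Rc x μ)‖ ≤ δG + γ * δR := by
    intro x μ r
    have e : -(G₂' x μ r * Rc' x μ) - -(G₂ x μ r * Rc x μ) = -((G₂' x μ r - G₂ x μ r) * Rc' x μ + G₂ x μ r * (Rc' x μ - Rc x μ)) := by noncomm_ring
    rw [e, norm_neg]
    calc _ ≤ ‖G₂' x μ r - G₂ x μ r‖ * ‖Rc' x μ‖ + ‖G₂ x μ r‖ * ‖Rc' x μ - Rc x μ‖ := (norm_add_le _ _).trans (add_le_add (norm_mul_le _ _) (norm_mul_le _ _))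
      _ ≤ δG * 1 + γ * δR := add_le_add (mul_le_mul (hGG₂ x μ r) (hRc' x μ) (norm_nonneg _) hδG) (mul_le_mul (hG₂ x μ r) (hRR x μ) (norm_nonneg _) hγ)
      _ = δG + γ * δR := by rw [mul_one]
  have h3 : ‖combOp n L M V' (fun x μ r => -(G₂' x μ r * Rc' x μ)) (fun c => c.1 + unitVec (fine n M) c.2) b i
        - combOp n L M V (fun x μ r => -(G₂ x μ r * Rc x μ)) (fun c => c.1 + unitVec (fine n M) c.2) b i‖
      ≤ d * (δG + γ * δR + γ * δT) * blockInd n L M (b.1.1 + unitVec (fine n M) b.1.2) i.1.1 :=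
    norm_combOp_sub_apply_le n L M hγ hc hV hV' hVV (δG := δG + γ * δR) hG₂R hG₂R' (fun c => c.1 + unitVec (fine n M) c.2) b i
  -- term 4: axis
  have h4 : ‖axisOp n L M V' G₃' b i - axisOp n L M V G₃ b i‖ ≤ (δG + γ * δT) * blockInd n L M b.1.1 i.1.1 :=
    norm_axisOp_sub_apply_le n L M hγ hc hV hV' hVV hG₃ hGG₃ b i
  have hq₁ := blockInd_le_qtwo_left n L M b.1 i.1
  have hq₂ := blockInd_le_qtwo_right n L M b.1 i.1
  have hsum : blockInd n L M b.1.1 i.1.1 + blockInd n L M (b.1.1 + unitVec (fine n M) b.1.2) i.1.1 = (L : ℝ) ^ d * qtwo n L M b.1 i.1 := by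
    rw [qtwo, ← mul_assoc, mul_inv_cancel₀ hL.ne', one_mul]
  have e : Qrem n L M V' G₁' G₂' G₃' Rc' b i - Qrem n L M V G₁ G₂ G₃ Rc b i
      = (combOp n L M V' G₁' (fun c => c.1) b i - combOp n L M V G₁ (fun c => c.1) b i)
        + (Qstep n L M (fun x r μ s => G₁' x μ r * Smain n L M V' x r μ s) b i - Qstep n L M (fun x r μ s => G₁ x μ r * Smain n L M V x r μ s) b i)
        + (combOp n L M V' (fun x μ r => -(G₂' x μ r * Rc' x μ)) (fun c => c.1 + unitVec (fine n M) c.2) b i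
            - combOp n L M V (fun x μ r => -(G₂ x μ r * Rc x μ)) (fun c => c.1 + unitVec (fine n M) c.2) b i)
        + (axisOp n L M V' G₃' b i - axisOp n L M V G₃ b i) := by
    simp only [Qrem, Matrix.add_apply]; ring
  rw [e]
  have key : d * (δG + γ * δT) * blockInd n L M b.1.1 i.1.1 + (δG + γ * δT) * (blockInd n L M b.1.1 i.1.1 + blockInd n L M (b.1.1 + unitVec (fine n M) b.1.2) i.1.1)
      + d * (δG + γ * δR + γ * δT) * blockInd n L M (b.1.1 + unitVec (fine n M) b.1.2) i.1.1 + (δG + γ * δT) * blockInd n L M b.1.1 i.1.1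
      ≤ (2 * d + 2) * (L : ℝ) ^ d * (δG + γ * (δR + 2 * δT)) * qtwo n L M b.1 i.1 := by
    rw [hsum]
    have hX0 : 0 ≤ (L : ℝ) ^ d * qtwo n L M b.1 i.1 := by rw [← hsum]; exact add_nonneg (blockInd_nonneg n L M _ _) (blockInd_nonneg n L M _ _)
    have a1 : d * (δG + γ * δT) * blockInd n L M b.1.1 i.1.1 ≤ d * (δG + γ * (δR + 2 * δT)) * ((L : ℝ) ^ d * qtwo n L M b.1 i.1) :=
      mul_le_mul (mul_le_mul_of_nonneg_left (by nlinarith) hd) hq₁ (blockInd_nonneg n L M _ _) (by positivity)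
    have a2 : (δG + γ * δT) * ((L : ℝ) ^ d * qtwo n L M b.1 i.1) ≤ (δG + γ * (δR + 2 * δT)) * ((L : ℝ) ^ d * qtwo n L M b.1 i.1) :=
      mul_le_mul_of_nonneg_right (by nlinarith) hX0
    have a3 : d * (δG + γ * δR + γ * δT) * blockInd n L M (b.1.1 + unitVec (fine n M) b.1.2) i.1.1 ≤ d * (δG + γ * (δR + 2 * δT)) * ((L : ℝ) ^ d * qtwo n L M b.1 i.1) :=
      mul_le_mul (mul_le_mul_of_nonneg_left (by nlinarith) hd) hq₂ (blockInd_nonneg n L M _ _) (by positivity)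
    have a4 : (δG + γ * δT) * blockInd n L M b.1.1 i.1.1 ≤ (δG + γ * (δR + 2 * δT)) * ((L : ℝ) ^ d * qtwo n L M b.1 i.1) :=
      mul_le_mul (by nlinarith) hq₁ (blockInd_nonneg n L M _ _) (by positivity)
    calc _ ≤ d * (δG + γ * (δR + 2 * δT)) * ((L : ℝ) ^ d * qtwo n L M b.1 i.1) + (δG + γ * (δR + 2 * δT)) * ((L : ℝ) ^ d * qtwo n L M b.1 i.1)
          + d * (δG + γ * (δR + 2 * δT)) * ((L : ℝ) ^ d * qtwo n L M b.1 i.1) + (δG + γ * (δR + 2 * δT)) * ((L : ℝ) ^ d * qtwo n L M b.1 i.1) :=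
          add_le_add (add_le_add (add_le_add a1 a2) a3) a4
      _ = (2 * d + 2) * (L : ℝ) ^ d * (δG + γ * (δR + 2 * δT)) * qtwo n L M b.1 i.1 := by ring
  exact le_trans ((norm_add_le _ _).trans (add_le_add ((norm_add_le _ _).trans (add_le_add ((norm_add_le _ _).trans (add_le_add h1 h2)) h3)) h4)) key

/-- **THE REMAINDER AS A FUNCTION OF ITS DATA** (operator norm):
`‖Q″(V′,G′,R̄′) − Q″(V,G,R̄)‖ ≤ card o·2d·(2d+2)L^d·(δ_G + γ(δ_R + 2((1+c)^{(d+1)L} − 1)))·(√(L^d))⁻¹`. [folklore] -/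
theorem opNorm_Qrem_sub_le (hγ : 0 ≤ γ) (hc : 0 ≤ c) (hV : ∀ ν b, ‖V ν b‖ ≤ 1) (hV' : ∀ ν b, ‖V' ν b‖ ≤ 1) (hVV : ∀ ν b, ‖V' ν b - V ν b‖ ≤ c)
    {G₁ G₂ G₁' G₂' : Tor (fine n M) → Fin d → (Fin d → Fin L) → Matrix o o ℂ} {G₃ Rc G₃' Rc' : Tor (fine n M) → Fin d → Matrix o o ℂ}
    (hG₁ : ∀ x μ r, ‖G₁ x μ r‖ ≤ γ) (hG₂ : ∀ x μ r, ‖G₂ x μ r‖ ≤ γ) (hG₃ : ∀ x μ, ‖G₃ x μ‖ ≤ γ) (hRc : ∀ x μ, ‖Rc x μ‖ ≤ 1) (hRc' : ∀ x μ, ‖Rc' x μ‖ ≤ 1)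
    (hδG : 0 ≤ δG) (hδR : 0 ≤ δR)
    (hGG₁ : ∀ x μ r, ‖G₁' x μ r - G₁ x μ r‖ ≤ δG) (hGG₂ : ∀ x μ r, ‖G₂' x μ r - G₂ x μ r‖ ≤ δG) (hGG₃ : ∀ x μ, ‖G₃' x μ - G₃ x μ‖ ≤ δG)
    (hRR : ∀ x μ, ‖Rc' x μ - Rc x μ‖ ≤ δR) :
    ‖Qrem n L M V' G₁' G₂' G₃' Rc' - Qrem n L M V G₁ G₂ G₃ Rc‖
      ≤ Fintype.card o * (2 * d * ((2 * d + 2) * (L : ℝ) ^ d * (δG + γ * (δR + 2 * ((1 + c) ^ ((d + 1) * L) - 1))))) * (Real.sqrt ((L : ℝ) ^ d))⁻¹ := by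
  have hδT : 0 ≤ (1 + c) ^ ((d + 1) * L) - 1 := by have := one_le_pow₀ (M₀ := ℝ) (a := 1 + c) (by linarith) (n := (d + 1) * L); linarith
  refine opNorm_le_of_dominated n L M _ (by positivity) fun b i => ?_
  rw [Matrix.sub_apply]
  exact norm_Qrem_sub_apply_le n L M hγ hc hV hV' hVV hG₁ hG₂ hG₃ hRc hRc' hGG₁ hGG₂ hGG₃ hRR b i

end Diff

end Summit.QuantumFields.BalabanUV.T4Continuum.NE2.OneStepRemainderLipschitz

end
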